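import Mathlib
import Literature.NumberTheory.LFunctions.Zhang2022.Section15CU1Bound
import Literature.NumberTheory.LFunctions.Zhang2022.AppendixALemma152Steps
import HarnessLib

/-!
# Zhang (2022), Lemma 15.3 value clause (repaired): the local quantities at `s₀ = 1 − βⱼ` versus
# their `β = 0` values — kernel-checked perturbation bounds `O((|b₁|+|b₂|+|bⱼ|) log q)`

Topic `Literature/NumberTheory/LFunctions/Zhang2022` (Landau–Siegel audit tree; verdict-neutral).
Y. Zhang, *Discrete mean estimates and the Landau–Siegel zero*, arXiv:2211.02515v1 (2022)
[Zhang2022LandauSiegel] — **an unrefereed manuscript under adjudication; nothing in this file asserts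
or denies its Theorems 1–2.** ZHANG-L discharge lane (WP15), file 8 of the chain towards the leaf
`Typed.Section15C.Lemma153RpI`: the second clause of Lemma 15.3 ("Further we have
`𝒰₁ⱼ(1) = φ(D)²D⁻²∏_{(q,D)=1}(1−q⁻²)²/(1−χ(q)q⁻²) + O(α₁)`", p. 87, tex L4349; App. A u031/u032,
p. 105) rests on comparing, prime by prime, the local quantities entering `𝔲ᴿ₁ⱼ(q,1)` with their
values at `β₁ = β₂ = βⱼ = 0`. With `u = q⁻¹`, `v = χ(q)`, `E = (|b₁|+|b₂|+|bⱼ|) log q` this file PROVES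
(theorems only; no definitions, no facts):

* `norm_T1_sub_le` — `‖Σ_{r≥1}(vq/(q−1))κ₁(q^{r−1})q^{−rs₀} − (vq/(q−1))·u/(1−u)‖ ≤ 8Eu`;
* `norm_Er_sub_le`, `norm_T2_sub_le` — `κ̃₁(qʳ;1) − κ₁(qʳ)` against `vu/(1−vu)`, and
  `‖Σ_{r≥1}(κ₁(qʳ) − κ̃₁(qʳ;1))q^{−rs₀} + (vu/(1−vu))(u/(1−u))‖ ≤ C_W·E·u²`;
* `norm_lam1_sub_model_le` — `‖λ₁(q) − (1−vu)‖ ≤ 4Eu` (App. A u026 in the needed uniform form);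
* `norm_S11_sub_model_le` — `‖Σ_{r≥1}ξ₁(qʳ;1,1)q^{−rs₀} − A0u/(1−u)‖ ≤ 58Eu`, `A0 = 1/(1−vu) − v/(1−u)`
  (App. A u025/u027 via `AppendixALocal.norm_rSumLocal_sub_le`).

All bounds are uniform in the prime `q` and in `D` (no smallness of `E` is assumed).

## References

* Y. Zhang, arXiv:2211.02515v1 (2022), §15 Lemma 15.3 p. 87; App. A pp. 104–105.
  [cite: Zhang2022LandauSiegel, App. A p. 105]
-/

noncomputable section

open Complex Real Filter Topology Finset

namespace Literature.NumberTheory.LFunctions.Zhang2022.Lemma153Rp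

open Literature.NumberTheory.LFunctions.Zhang2022
open Literature.NumberTheory.LFunctions.Zhang2022.Typed.Section15A
open Literature.NumberTheory.LFunctions.Zhang2022.Typed.Section15B
variable (c' : ℝ) {D : ℕ} (χ : DirichletCharacter ℂ D)

/-! ## §1. `q^{−(1−βⱼ)} = q⁻¹·q^{βⱼ}` and powers -/

/-- `q^{−(1−βⱼ)} = q⁻¹·q^{βⱼ}`. [cite: Zhang2022LandauSiegel, §2 (2.13)] -/
theorem cpow_neg_one_sub_betaJ {q : ℕ} (hq : q.Prime) (j : ℕ) :
    (q : ℂ) ^ (-(1 - Skeleton.betaJ c' D j)) = (q : ℂ)⁻¹ * (q : ℂ) ^ Skeleton.betaJ c' D j := by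
  have hqC : (q : ℂ) ≠ 0 := by exact_mod_cast hq.ne_zero
  rw [show -(1 - Skeleton.betaJ c' D j) = -1 + Skeleton.betaJ c' D j by ring, Complex.cpow_add _ _ hqC,
    Complex.cpow_neg_one]

/-- `1/q^{r(1−βⱼ)} = (q⁻¹q^{βⱼ})ʳ`. [cite: Zhang2022LandauSiegel, §2 (2.13)] -/
theorem inv_cpow_nat_mul_eq {q : ℕ} (hq : q.Prime) (j r : ℕ) :
    ((q : ℂ) ^ ((r : ℂ) * (1 - Skeleton.betaJ c' D j)))⁻¹ =
      ((q : ℂ)⁻¹ * (q : ℂ) ^ Skeleton.betaJ c' D j) ^ r := by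
  rw [← cpow_neg_one_sub_betaJ c' hq j, Complex.cpow_nat_mul, ← inv_pow, ← Complex.cpow_neg]

/-- `‖q^{βⱼ} − 1‖ ≤ |b| log q` when `βⱼ = b·i`. [cite: Zhang2022LandauSiegel, §2 (2.13)] -/
theorem norm_cpow_betaJ_sub_one_le {q : ℕ} (hq : q.Prime) (j : ℕ) {b : ℝ}
    (hb : Skeleton.betaJ c' D j = (b : ℂ) * I) :
    ‖(q : ℂ) ^ Skeleton.betaJ c' D j - 1‖ ≤ |b| * Real.log q := by
  rw [Typed.Section15C.natCast_cpow_betaJ_eq_powI c' j hq.pos hb]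
  have h := MeanSquareMajorant.norm_powI_sub_one_le (-b) hq.pos
  rwa [abs_neg] at h

/-- `‖(q⁻¹q^{βⱼ})ʳ − q^{−r}‖ ≤ r|b| log q · q^{−r}`. [cite: Zhang2022LandauSiegel, §2 (2.13)] -/
theorem norm_x0_pow_sub_le {q : ℕ} (hq : q.Prime) (j : ℕ) {b : ℝ}
    (hb : Skeleton.betaJ c' D j = (b : ℂ) * I) (r : ℕ) :
    ‖((q : ℂ)⁻¹ * (q : ℂ) ^ Skeleton.betaJ c' D j) ^ r - ((q : ℂ)⁻¹) ^ r‖ ≤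
      r * (|b| * Real.log q) * ((q : ℝ)⁻¹) ^ r := by
  have ht1 : ‖(q : ℂ) ^ Skeleton.betaJ c' D j‖ ≤ 1 := (norm_cpow_betaJ c' hq j).le
  rw [mul_pow, ← mul_sub_one, norm_mul, norm_pow, norm_inv, Complex.norm_natCast]
  have h := AppendixALocal.norm_pow_sub_one_le ht1 r
  have h2 := norm_cpow_betaJ_sub_one_le c' hq j hb
  calc ((q : ℝ)⁻¹) ^ r * ‖((q : ℂ) ^ Skeleton.betaJ c' D j) ^ r - 1‖
      ≤ ((q : ℝ)⁻¹) ^ r * (r * (|b| * Real.log q)) := by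
        gcongr
        exact h.trans (mul_le_mul_of_nonneg_left h2 (Nat.cast_nonneg r))
    _ = r * (|b| * Real.log q) * ((q : ℝ)⁻¹) ^ r := by ring

/-- `Σ_m (m+1)(1/2)^m = 4` bound: `Σ_m (m+1)θ^m ≤ 4` for `0 ≤ θ ≤ 1/2`. [folklore] -/
private theorem tsum_succ_mul_pow_le_four {θ : ℝ} (h0 : 0 ≤ θ) (h1 : θ ≤ 1 / 2) :
    Summable (fun m : ℕ => ((m : ℝ) + 1) * θ ^ m) ∧ ∑' m : ℕ, ((m : ℝ) + 1) * θ ^ m ≤ 4 := by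
  have hθ1 : θ < 1 := by linarith
  have hs := AppendixALocal.hasSum_add_mul_geometric h0 hθ1 1
  have hfun : (fun k : ℕ => ((1 : ℝ) + k) * θ ^ k) = fun m : ℕ => ((m : ℝ) + 1) * θ ^ m := by
    funext m; ring
  rw [hfun] at hs
  refine ⟨hs.summable, ?_⟩
  rw [hs.tsum_eq]
  have h1θ : 1 / 2 ≤ 1 - θ := by linarith
  have ha : 1 / (1 - θ) ≤ 2 := by rw [div_le_iff₀ (by linarith)]; linarith
  have hb : θ / (1 - θ) ^ 2 ≤ 2 := by
    rw [div_le_iff₀ (by positivity)]; nlinarith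
  linarith

/-! ## §2. `T₁ = Σ_{r≥1}(χ(q)q/(q−1))κ₁(q^{r−1})q^{−rs₀}` against `(χ(q)q/(q−1))·u/(1−u)` -/

/-- **`‖T₁ − T₁⁰‖ ≤ 8Eu`**: `T₁ = c·Σ_{m≥0} κ₁(qᵐ)x₀^{m+1}` (`x₀ = q⁻¹q^{βⱼ}`, `c = χ(q)q/(q−1)`,
`|c| ≤ 2`), `T₁⁰ = c·Σ_m u^{m+1} = c·u/(1−u)`, and `‖κ₁(qᵐ)x₀^{m+1} − u^{m+1}‖ ≤ (m+1)E u^{m+1}`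
(`‖κ₁(qᵐ) − 1‖ ≤ m(|b₁|+|b₂|)log q`, `‖x₀^{m+1} − u^{m+1}‖ ≤ (m+1)|bⱼ|log q·u^{m+1}`), `Σ(m+1)uᵐ ≤ 4`.
[cite: Zhang2022LandauSiegel, App. A p. 105] -/
theorem norm_T1_sub_le {q : ℕ} (hq : q.Prime) (j : ℕ) {b : ℝ} (hb : Skeleton.betaJ c' D j = (b : ℂ) * I) :
    ‖(∑' r : ℕ, if r = 0 then (0 : ℂ) else
        χ (q : ZMod D) * (q : ℂ) / ((q : ℂ) - 1) * kappa1 c' D (q ^ (r - 1)) /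
          (q : ℂ) ^ ((r : ℂ) * (1 - Skeleton.betaJ c' D j))) -
      χ (q : ZMod D) * (q : ℂ) / ((q : ℂ) - 1) * ((q : ℂ)⁻¹ / (1 - (q : ℂ)⁻¹))‖ ≤
      8 * ((|Skeleton.b1 c' D| + |Skeleton.b2 c' D| + |b|) * Real.log q) * (q : ℝ)⁻¹ := by
  set c : ℂ := χ (q : ZMod D) * (q : ℂ) / ((q : ℂ) - 1) with hc
  set t : ℂ := (q : ℂ) ^ Skeleton.betaJ c' D j with ht
  set u : ℂ := (q : ℂ)⁻¹ with hu
  set x₀ : ℂ := u * t with hx₀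
  set bb : ℝ := |Skeleton.b1 c' D| + |Skeleton.b2 c' D| with hbb
  set L : ℝ := Real.log q with hL
  have hL0 : 0 ≤ L := Real.log_natCast_nonneg q
  have hbb0 : 0 ≤ bb := by positivity
  have hq0 : (0 : ℝ) < q := by exact_mod_cast hq.pos
  have hq2 : (2 : ℝ) ≤ q := by exact_mod_cast hq.two_le
  have hun : ‖u‖ = (q : ℝ)⁻¹ := by rw [hu, norm_inv, Complex.norm_natCast]
  have hu12 : (q : ℝ)⁻¹ ≤ 1 / 2 := by rw [one_div]; exact inv_anti₀ (by norm_num) hq2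
  have hun1 : ‖u‖ < 1 := by rw [hun]; linarith
  have htn : ‖t‖ = 1 := norm_cpow_betaJ c' hq j
  have hx₀n : ‖x₀‖ = (q : ℝ)⁻¹ := by rw [hx₀, norm_mul, hun, htn, mul_one]
  have hx₀1 : ‖x₀‖ < 1 := by rw [hx₀n]; linarith
  have hcn : ‖c‖ ≤ 2 := norm_chi_mul_div_sub_one_le χ hq
  -- the series as `Σ_m c κ₁(q^m) x₀^{m+1}` (shift `r = m+1`)
  set f : ℕ → ℂ := fun r => if r = 0 then (0 : ℂ) else
      c * kappa1 c' D (q ^ (r - 1)) / (q : ℂ) ^ ((r : ℂ) * (1 - Skeleton.betaJ c' D j)) with hf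
  have hfm : ∀ m : ℕ, f (m + 1) = c * (kappa1 c' D (q ^ m) * x₀ ^ (m + 1)) := by
    intro m
    have hm : m + 1 ≠ 0 := by omega
    simp only [hf, if_neg hm, Nat.add_sub_cancel]
    rw [div_eq_mul_inv, show (((m + 1 : ℕ) : ℂ)) = ((m + 1 : ℕ) : ℂ) from rfl,
      inv_cpow_nat_mul_eq c' hq j (m + 1), ← hu, ← ht, ← hx₀]
    ring
  -- termwise bound
  have hκ1 : ∀ m : ℕ, ‖kappa1 c' D (q ^ m) - 1‖ ≤ m * (bb * L) := fun m => by
    unfold kappa1; exact AppendixALocal.norm_kappa₁_prime_pow_sub_one_le _ _ hq m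
  have hterm : ∀ m : ℕ, ‖kappa1 c' D (q ^ m) * x₀ ^ (m + 1) - u ^ (m + 1)‖ ≤
      ((m : ℝ) + 1) * ((bb + |b|) * L) * ((q : ℝ)⁻¹) ^ (m + 1) := by
    intro m
    have e : kappa1 c' D (q ^ m) * x₀ ^ (m + 1) - u ^ (m + 1) =
        (kappa1 c' D (q ^ m) - 1) * x₀ ^ (m + 1) + (x₀ ^ (m + 1) - u ^ (m + 1)) := by ring
    rw [e]
    have h1 : ‖(kappa1 c' D (q ^ m) - 1) * x₀ ^ (m + 1)‖ ≤ (m * (bb * L)) * ((q : ℝ)⁻¹) ^ (m + 1) := by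
      rw [norm_mul, norm_pow, hx₀n]
      exact mul_le_mul_of_nonneg_right (hκ1 m) (by positivity)
    have h2 : ‖x₀ ^ (m + 1) - u ^ (m + 1)‖ ≤ ((m + 1 : ℕ) : ℝ) * (|b| * L) * ((q : ℝ)⁻¹) ^ (m + 1) := by
      rw [hx₀, hu]; exact norm_x0_pow_sub_le c' hq j hb (m + 1)
    have hm0 : (0 : ℝ) ≤ m := Nat.cast_nonneg m
    calc _ ≤ (m * (bb * L)) * ((q : ℝ)⁻¹) ^ (m + 1) + ((m + 1 : ℕ) : ℝ) * (|b| * L) * ((q : ℝ)⁻¹) ^ (m + 1) :=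
          (norm_add_le _ _).trans (add_le_add h1 h2)
      _ ≤ ((m : ℝ) + 1) * ((bb + |b|) * L) * ((q : ℝ)⁻¹) ^ (m + 1) := by
          push_cast
          have hp : 0 ≤ ((q : ℝ)⁻¹) ^ (m + 1) := by positivity
          nlinarith [mul_nonneg (mul_nonneg hbb0 hL0) hp, mul_nonneg (mul_nonneg (abs_nonneg b) hL0) hp]
  -- summability
  obtain ⟨hgeo_sum, hgeo_le⟩ := tsum_succ_mul_pow_le_four (θ := (q : ℝ)⁻¹) (by positivity) hu12
  set g : ℕ → ℝ := fun m => 2 * ((bb + |b|) * L) * (q : ℝ)⁻¹ * (((m : ℝ) + 1) * ((q : ℝ)⁻¹) ^ m) with hg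
  have hgsum : Summable g := hgeo_sum.mul_left _
  have hdiff : ∀ m, ‖f (m + 1) - c * u ^ (m + 1)‖ ≤ g m := by
    intro m
    rw [hfm m, ← mul_sub, norm_mul]
    calc ‖c‖ * ‖kappa1 c' D (q ^ m) * x₀ ^ (m + 1) - u ^ (m + 1)‖
        ≤ 2 * (((m : ℝ) + 1) * ((bb + |b|) * L) * ((q : ℝ)⁻¹) ^ (m + 1)) :=
          mul_le_mul hcn (hterm m) (norm_nonneg _) (by norm_num)
      _ = g m := by simp only [hg, pow_succ]; ring
  have hmodel : HasSum (fun m : ℕ => c * u ^ (m + 1)) (c * (u / (1 - u))) := by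
    have h := (hasSum_geometric_of_norm_lt_one hun1).mul_left (c * u)
    have hfun : (fun m : ℕ => c * u ^ (m + 1)) = fun i : ℕ => c * u * u ^ i := by funext m; ring
    have hval : c * (u / (1 - u)) = c * u * (1 - u)⁻¹ := by rw [div_eq_mul_inv]; ring
    rw [hfun, hval]; exact h
  have hfsum1 : Summable (fun m => f (m + 1)) := by
    have : Summable (fun m => f (m + 1) - c * u ^ (m + 1)) := Summable.of_norm_bounded hgsum hdiff
    simpa using this.add hmodel.summable
  have hf0 : f 0 = 0 := by simp [hf]
  have hfsum : Summable f := (summable_nat_add_iff 1).mp hfsum1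
  have htsum : ∑' r, f r = ∑' m, f (m + 1) := by rw [hfsum.tsum_eq_zero_add, hf0, zero_add]
  change ‖∑' r, f r - c * (u / (1 - u))‖ ≤ 8 * ((bb + |b|) * L) * (q : ℝ)⁻¹
  rw [htsum, ← hmodel.tsum_eq, ← Summable.tsum_sub hfsum1 hmodel.summable]
  calc ‖∑' m, (f (m + 1) - c * u ^ (m + 1))‖ ≤ ∑' m, ‖f (m + 1) - c * u ^ (m + 1)‖ :=
        norm_tsum_le_tsum_norm (Summable.of_norm_bounded hgsum hdiff).norm
    _ ≤ ∑' m, g m := (Summable.of_norm_bounded hgsum hdiff).norm.tsum_le_tsum hdiff hgsum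
    _ = 2 * ((bb + |b|) * L) * (q : ℝ)⁻¹ * ∑' m : ℕ, ((m : ℝ) + 1) * ((q : ℝ)⁻¹) ^ m := by
        rw [hg, tsum_mul_left]
    _ ≤ 2 * ((bb + |b|) * L) * (q : ℝ)⁻¹ * 4 := by gcongr
    _ = 8 * ((bb + |b|) * L) * (q : ℝ)⁻¹ := by ring

/-! ## §3. `E_r = κ̃₁(qʳ;1) − κ₁(qʳ)` against `vu/(1−vu)`, and `T₂` -/

/-- `Σ_k θ^k ≤ 2` and `Σ_k kθ^k ≤ 2` type bound: `Σ_k (a + k)θᵏ ≤ 2a + 2` for `0 ≤ θ ≤ 1/2`, `a ≥ 0`.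
[folklore] -/
private theorem tsum_add_mul_pow_le {θ : ℝ} (h0 : 0 ≤ θ) (h1 : θ ≤ 1 / 2) {a : ℝ} (ha : 0 ≤ a) :
    Summable (fun k : ℕ => (a + k) * θ ^ k) ∧ ∑' k : ℕ, (a + k) * θ ^ k ≤ 2 * a + 2 := by
  have hθ1 : θ < 1 := by linarith
  have hs := AppendixALocal.hasSum_add_mul_geometric h0 hθ1 a
  refine ⟨hs.summable, ?_⟩
  rw [hs.tsum_eq]
  have ha' : a / (1 - θ) ≤ 2 * a := by rw [div_le_iff₀ (by linarith)]; nlinarith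
  have hb : θ / (1 - θ) ^ 2 ≤ 2 := by rw [div_le_iff₀ (by positivity)]; nlinarith
  linarith

/-- **`‖(κ̃₁(qʳ;1) − κ₁(qʳ)) − vu/(1−vu)‖ ≤ (2r+4)(|b₁|+|b₂|) log q · u`** (`r ≥ 1`, `u = q⁻¹`,
`v = χ(q)`): `κ̃₁(qʳ;1) − κ₁(qʳ) = Σ_{k≥1} κ₁(q^{r+k})(vu)ᵏ` and `|κ₁(qᵐ) − 1| ≤ m(|b₁|+|b₂|)log q`.
[cite: Zhang2022LandauSiegel, App. A p. 104] -/
theorem norm_Er_sub_le {q : ℕ} (hq : q.Prime) {r : ℕ} (hr : 1 ≤ r) :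
    ‖(kappaTilde1 c' χ (q ^ r) 1 1 - kappa1 c' D (q ^ r)) -
        χ (q : ZMod D) * (q : ℂ)⁻¹ / (1 - χ (q : ZMod D) * (q : ℂ)⁻¹)‖ ≤
      (2 * r + 4) * ((|Skeleton.b1 c' D| + |Skeleton.b2 c' D|) * Real.log q) * (q : ℝ)⁻¹ := by
  set v : ℂ := χ (q : ZMod D) with hv
  set u : ℂ := (q : ℂ)⁻¹ with hu
  set bb : ℝ := |Skeleton.b1 c' D| + |Skeleton.b2 c' D| with hbb
  set L : ℝ := Real.log q with hL
  have hL0 : 0 ≤ L := Real.log_natCast_nonneg q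
  have hbb0 : 0 ≤ bb := by positivity
  have hq0 : (0 : ℝ) < q := by exact_mod_cast hq.pos
  have hq2 : (2 : ℝ) ≤ q := by exact_mod_cast hq.two_le
  have hvn : ‖v‖ ≤ 1 := χ.norm_le_one _
  have hun : ‖u‖ = (q : ℝ)⁻¹ := by rw [hu, norm_inv, Complex.norm_natCast]
  have hu12 : (q : ℝ)⁻¹ ≤ 1 / 2 := by rw [one_div]; exact inv_anti₀ (by norm_num) hq2
  have hvun : ‖v * u‖ ≤ (q : ℝ)⁻¹ := by
    rw [norm_mul, hun]; calc ‖v‖ * (q : ℝ)⁻¹ ≤ 1 * (q : ℝ)⁻¹ := by gcongr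
      _ = (q : ℝ)⁻¹ := one_mul _
  have hvu1 : ‖v * u‖ < 1 := by linarith
  -- the series
  rw [kappaTilde1_sub_kappa1_eq_tsum c' χ hq hr]
  have hterm : ∀ k : ℕ, kappa1 c' D (q ^ (r + (k + 1))) * χ ((q ^ (k + 1) : ℕ) : ZMod D) /
      ((q ^ (k + 1) : ℕ) : ℂ) = kappa1 c' D (q ^ (r + (k + 1))) * (v * u) ^ (k + 1) := by
    intro k
    rw [chi_prime_pow, Nat.cast_pow, div_eq_mul_inv, ← inv_pow, mul_pow, hv, hu, mul_assoc]
  simp_rw [hterm]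
  have hmodel : HasSum (fun k : ℕ => (v * u) ^ (k + 1)) (v * u / (1 - v * u)) := by
    have h := (hasSum_geometric_of_norm_lt_one hvu1).mul_left (v * u)
    have hfun : (fun k : ℕ => (v * u) ^ (k + 1)) = fun i : ℕ => v * u * (v * u) ^ i := by
      funext k; ring
    have hval : v * u / (1 - v * u) = v * u * (1 - v * u)⁻¹ := div_eq_mul_inv _ _
    rw [hfun, hval]; exact h
  set g : ℕ → ℝ := fun k => bb * L * (q : ℝ)⁻¹ * ((((r : ℝ) + 1) + k) * ((q : ℝ)⁻¹) ^ k) with hg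
  obtain ⟨hgs, hgle⟩ := tsum_add_mul_pow_le (θ := (q : ℝ)⁻¹) (by positivity) hu12
    (a := (r : ℝ) + 1) (by positivity)
  have hgsum : Summable g := hgs.mul_left _
  have hdiff : ∀ k : ℕ, ‖kappa1 c' D (q ^ (r + (k + 1))) * (v * u) ^ (k + 1) - (v * u) ^ (k + 1)‖ ≤ g k := by
    intro k
    rw [← sub_one_mul, norm_mul, norm_pow]
    have h1 : ‖kappa1 c' D (q ^ (r + (k + 1))) - 1‖ ≤ ((r + (k + 1) : ℕ) : ℝ) * (bb * L) := by
      unfold kappa1; exact AppendixALocal.norm_kappa₁_prime_pow_sub_one_le _ _ hq _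
    have h2 : ‖v * u‖ ^ (k + 1) ≤ ((q : ℝ)⁻¹) ^ (k + 1) := pow_le_pow_left₀ (norm_nonneg _) hvun _
    calc ‖kappa1 c' D (q ^ (r + (k + 1))) - 1‖ * ‖v * u‖ ^ (k + 1)
        ≤ (((r + (k + 1) : ℕ) : ℝ) * (bb * L)) * ((q : ℝ)⁻¹) ^ (k + 1) :=
          mul_le_mul h1 h2 (by positivity) (by positivity)
      _ = g k := by simp only [hg]; push_cast; ring
  have hsum1 : Summable (fun k : ℕ => kappa1 c' D (q ^ (r + (k + 1))) * (v * u) ^ (k + 1)) := by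
    have := Summable.of_norm_bounded hgsum hdiff
    simpa using this.add hmodel.summable
  rw [← hmodel.tsum_eq, ← Summable.tsum_sub hsum1 hmodel.summable]
  calc ‖∑' k, (kappa1 c' D (q ^ (r + (k + 1))) * (v * u) ^ (k + 1) - (v * u) ^ (k + 1))‖
      ≤ ∑' k, ‖kappa1 c' D (q ^ (r + (k + 1))) * (v * u) ^ (k + 1) - (v * u) ^ (k + 1)‖ :=
        norm_tsum_le_tsum_norm (Summable.of_norm_bounded hgsum hdiff).norm
    _ ≤ ∑' k, g k := (Summable.of_norm_bounded hgsum hdiff).norm.tsum_le_tsum hdiff hgsum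
    _ = bb * L * (q : ℝ)⁻¹ * ∑' k : ℕ, (((r : ℝ) + 1) + k) * ((q : ℝ)⁻¹) ^ k := by rw [hg, tsum_mul_left]
    _ ≤ bb * L * (q : ℝ)⁻¹ * (2 * ((r : ℝ) + 1) + 2) := by gcongr
    _ = (2 * r + 4) * (bb * L) * (q : ℝ)⁻¹ := by ring

/-- **`‖T₂ − T₂⁰‖ ≤ 16Eu²`** where `T₂ = Σ_{r≥1}(κ₁(qʳ) − κ̃₁(qʳ;1))q^{−rs₀}`,
`T₂⁰ = −(vu/(1−vu))·u/(1−u)` (`E = (|b₁|+|b₂|+|bⱼ|) log q`, `u = q⁻¹`):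
termwise `‖E_r x₀ʳ − E0uʳ‖ ≤ (2r+4)E u^{r+1}` (`norm_Er_sub_le`, `‖E0‖ ≤ 2u`, `‖x₀ʳ − uʳ‖ ≤ r|bⱼ|log q·uʳ`).
[cite: Zhang2022LandauSiegel, App. A p. 105] -/
theorem norm_T2_sub_le [NeZero D] {q : ℕ} (hq : q.Prime) (j : ℕ) {b : ℝ}
    (hb : Skeleton.betaJ c' D j = (b : ℂ) * I) :
    ‖(∑' r : ℕ, if r = 0 then (0 : ℂ) else
        (kappa1 c' D (q ^ r) - kappaTilde1 c' χ (q ^ r) 1 1) /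
          (q : ℂ) ^ ((r : ℂ) * (1 - Skeleton.betaJ c' D j))) -
      (-(χ (q : ZMod D) * (q : ℂ)⁻¹ / (1 - χ (q : ZMod D) * (q : ℂ)⁻¹) *
        ((q : ℂ)⁻¹ / (1 - (q : ℂ)⁻¹))))‖ ≤
      16 * ((|Skeleton.b1 c' D| + |Skeleton.b2 c' D| + |b|) * Real.log q) * ((q : ℝ)⁻¹) ^ 2 := by
  set v : ℂ := χ (q : ZMod D) with hv
  set u : ℂ := (q : ℂ)⁻¹ with hu
  set t : ℂ := (q : ℂ) ^ Skeleton.betaJ c' D j with ht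
  set x₀ : ℂ := u * t with hx₀
  set E0 : ℂ := v * u / (1 - v * u) with hE0
  set bb : ℝ := |Skeleton.b1 c' D| + |Skeleton.b2 c' D| with hbb
  set L : ℝ := Real.log q with hL
  have hL0 : 0 ≤ L := Real.log_natCast_nonneg q
  have hbb0 : 0 ≤ bb := by positivity
  have hq0 : (0 : ℝ) < q := by exact_mod_cast hq.pos
  have hq2 : (2 : ℝ) ≤ q := by exact_mod_cast hq.two_le
  have hvn : ‖v‖ ≤ 1 := χ.norm_le_one _
  have hun : ‖u‖ = (q : ℝ)⁻¹ := by rw [hu, norm_inv, Complex.norm_natCast]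
  have hu12 : (q : ℝ)⁻¹ ≤ 1 / 2 := by rw [one_div]; exact inv_anti₀ (by norm_num) hq2
  have hun1 : ‖u‖ < 1 := by rw [hun]; linarith
  have htn : ‖t‖ = 1 := norm_cpow_betaJ c' hq j
  have hx₀n : ‖x₀‖ = (q : ℝ)⁻¹ := by rw [hx₀, norm_mul, hun, htn, mul_one]
  have hE0n : ‖E0‖ ≤ 2 * (q : ℝ)⁻¹ := by
    have hden : (1 : ℝ) / 2 ≤ ‖1 - v * u‖ := by
      have h1 : ‖v * u‖ ≤ 1 / 2 := by
        rw [norm_mul, hun]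
        calc ‖v‖ * (q : ℝ)⁻¹ ≤ 1 * (1 / 2) := by gcongr
          _ = 1 / 2 := one_mul _
      have := norm_sub_norm_le (1 : ℂ) (v * u); rw [norm_one] at this; linarith
    rw [hE0, norm_div, norm_mul, hun, div_le_iff₀ (by linarith)]
    calc ‖v‖ * (q : ℝ)⁻¹ ≤ 1 * (q : ℝ)⁻¹ := by gcongr
      _ ≤ 2 * (q : ℝ)⁻¹ * ‖1 - v * u‖ := by nlinarith [inv_nonneg.mpr hq0.le]
  -- the series as `−Σ_{r≥1} E_r x₀^r` with `E_r = κ̃₁(q^r;1) − κ₁(q^r)`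
  set f : ℕ → ℂ := fun r => if r = 0 then (0 : ℂ) else
      (kappa1 c' D (q ^ r) - kappaTilde1 c' χ (q ^ r) 1 1) /
        (q : ℂ) ^ ((r : ℂ) * (1 - Skeleton.betaJ c' D j)) with hf
  have hfm : ∀ m : ℕ, f (m + 1) =
      -((kappaTilde1 c' χ (q ^ (m + 1)) 1 1 - kappa1 c' D (q ^ (m + 1))) * x₀ ^ (m + 1)) := by
    intro m
    have hm : m + 1 ≠ 0 := by omega
    simp only [hf, if_neg hm]
    rw [div_eq_mul_inv, show (((m + 1 : ℕ) : ℂ)) = ((m + 1 : ℕ) : ℂ) from rfl,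
      inv_cpow_nat_mul_eq c' hq j (m + 1), ← hu, ← ht, ← hx₀]
    ring
  -- termwise bound
  set g : ℕ → ℝ := fun m => ((bb + |b|) * L) * ((q : ℝ)⁻¹) ^ 2 *
    ((2 * ((m : ℝ) + 1) + 4) * ((q : ℝ)⁻¹) ^ m) with hg
  have hgeo := tsum_add_mul_pow_le (θ := (q : ℝ)⁻¹) (by positivity) hu12 (a := (3 : ℝ)) (by norm_num)
  have hgsum : Summable g := by
    refine ((hgeo.1.mul_left (2 * ((bb + |b|) * L) * ((q : ℝ)⁻¹) ^ 2))).congr fun m => ?_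
    simp only [hg]; ring
  have hgtsum : ∑' m, g m ≤ 16 * ((bb + |b|) * L) * ((q : ℝ)⁻¹) ^ 2 := by
    have e : ∀ m : ℕ, g m = 2 * ((bb + |b|) * L) * ((q : ℝ)⁻¹) ^ 2 * ((3 + (m : ℝ)) * ((q : ℝ)⁻¹) ^ m) := by
      intro m; simp only [hg]; ring
    rw [tsum_congr e, tsum_mul_left]
    have h8 : ∑' m : ℕ, (3 + (m : ℝ)) * ((q : ℝ)⁻¹) ^ m ≤ 8 := by linarith [hgeo.2]
    have hc0 : 0 ≤ 2 * ((bb + |b|) * L) * ((q : ℝ)⁻¹) ^ 2 := by positivity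
    nlinarith
  have hdiff : ∀ m, ‖f (m + 1) - (-(E0 * u ^ (m + 1)))‖ ≤ g m := by
    intro m
    rw [hfm m]
    set Er : ℂ := kappaTilde1 c' χ (q ^ (m + 1)) 1 1 - kappa1 c' D (q ^ (m + 1)) with hEr
    have e : -(Er * x₀ ^ (m + 1)) - -(E0 * u ^ (m + 1)) =
        -((Er - E0) * x₀ ^ (m + 1) + E0 * (x₀ ^ (m + 1) - u ^ (m + 1))) := by ring
    rw [e, norm_neg]
    have h1 := norm_Er_sub_le c' χ hq (r := m + 1) (by omega)
    have h2 := norm_x0_pow_sub_le c' hq j hb (m + 1)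
    have hm1 : (0 : ℝ) ≤ (m : ℝ) + 1 := by positivity
    have hA : ‖(Er - E0) * x₀ ^ (m + 1)‖ ≤
        ((2 * ((m + 1 : ℕ) : ℝ) + 4) * (bb * L) * (q : ℝ)⁻¹) * ((q : ℝ)⁻¹) ^ (m + 1) := by
      rw [norm_mul, norm_pow, hx₀n]
      exact mul_le_mul_of_nonneg_right h1 (by positivity)
    have hB : ‖E0 * (x₀ ^ (m + 1) - u ^ (m + 1))‖ ≤
        (2 * (q : ℝ)⁻¹) * (((m + 1 : ℕ) : ℝ) * (|b| * L) * ((q : ℝ)⁻¹) ^ (m + 1)) := by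
      rw [norm_mul]
      refine mul_le_mul hE0n ?_ (norm_nonneg _) (by positivity)
      rw [hx₀, hu]; exact h2
    calc ‖(Er - E0) * x₀ ^ (m + 1) + E0 * (x₀ ^ (m + 1) - u ^ (m + 1))‖
        ≤ ((2 * ((m + 1 : ℕ) : ℝ) + 4) * (bb * L) * (q : ℝ)⁻¹) * ((q : ℝ)⁻¹) ^ (m + 1) +
            (2 * (q : ℝ)⁻¹) * (((m + 1 : ℕ) : ℝ) * (|b| * L) * ((q : ℝ)⁻¹) ^ (m + 1)) :=
          (norm_add_le _ _).trans (add_le_add hA hB)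
      _ ≤ g m := by
          simp only [hg]; push_cast
          have hp : 0 ≤ ((q : ℝ)⁻¹) ^ m := by positivity
          have hqi : 0 ≤ (q : ℝ)⁻¹ := by positivity
          rw [pow_succ]
          nlinarith [mul_nonneg (mul_nonneg hbb0 hL0) hp, mul_nonneg (mul_nonneg (abs_nonneg b) hL0) hp,
            mul_nonneg (mul_nonneg (mul_nonneg hbb0 hL0) hp) hqi,
            mul_nonneg (mul_nonneg (mul_nonneg (abs_nonneg b) hL0) hp) hqi, hm1]
  have hmodel : HasSum (fun m : ℕ => -(E0 * u ^ (m + 1))) (-(E0 * (u / (1 - u)))) := by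
    have h := ((hasSum_geometric_of_norm_lt_one hun1).mul_left (E0 * u)).neg
    have hfun : (fun m : ℕ => -(E0 * u ^ (m + 1))) = fun i : ℕ => -(E0 * u * u ^ i) := by funext m; ring
    have hval : -(E0 * (u / (1 - u))) = -(E0 * u * (1 - u)⁻¹) := by rw [div_eq_mul_inv]; ring
    rw [hfun, hval]; exact h
  have hfsum1 : Summable (fun m => f (m + 1)) := by
    have := Summable.of_norm_bounded hgsum hdiff
    simpa using this.add hmodel.summable
  have hf0 : f 0 = 0 := by simp [hf]
  have hfsum : Summable f := (summable_nat_add_iff 1).mp hfsum1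
  have htsum : ∑' r, f r = ∑' m, f (m + 1) := by rw [hfsum.tsum_eq_zero_add, hf0, zero_add]
  change ‖∑' r, f r - -(E0 * (u / (1 - u)))‖ ≤ 16 * ((bb + |b|) * L) * ((q : ℝ)⁻¹) ^ 2
  rw [htsum, ← hmodel.tsum_eq, ← Summable.tsum_sub hfsum1 hmodel.summable]
  calc ‖∑' m, (f (m + 1) - -(E0 * u ^ (m + 1)))‖ ≤ ∑' m, ‖f (m + 1) - -(E0 * u ^ (m + 1))‖ :=
        norm_tsum_le_tsum_norm (Summable.of_norm_bounded hgsum hdiff).norm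
    _ ≤ ∑' m, g m := (Summable.of_norm_bounded hgsum hdiff).norm.tsum_le_tsum hdiff hgsum
    _ ≤ _ := hgtsum

/-! ## §4. `λ₁(q)` against `1 − χ(q)q⁻¹` (App. A u026, uniform form) -/

/-- **`‖λ₁(q) − (1 − χ(q)q⁻¹)‖ ≤ 4(|b₁|+|b₂|) log q · q⁻¹`** for every prime `q` and every `D`
(`AppendixALocal.norm_lamOneLocal_sub_le` with `‖q^{−β_i} − 1‖ ≤ |b_i| log q`).
[cite: Zhang2022LandauSiegel, App. A p. 104] -/
theorem norm_lam1_sub_model_le [NeZero D] {q : ℕ} (hq : q.Prime) :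
    ‖lam1 c' χ q 1 - (1 - χ (q : ZMod D) * (q : ℂ)⁻¹)‖ ≤
      4 * ((|Skeleton.b1 c' D| + |Skeleton.b2 c' D|) * Real.log q) * (q : ℝ)⁻¹ := by
  have hv : ‖χ (q : ZMod D)‖ ≤ 1 := χ.norm_le_one _
  have hu : ‖(q : ℂ)⁻¹‖ ≤ 1 / 2 := AppendixALocal.norm_inv_natCast_le_half hq.two_le
  rw [AppendixALocal.lam1_prime_eq c' χ hq]
  have h := AppendixALocal.norm_lamOneLocal_sub_le hu hv
    (AppendixALocal.norm_powI_le_one (Skeleton.b1 c' D) q)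
    (AppendixALocal.norm_powI_le_one (Skeleton.b2 c' D) q)
  have hx := MeanSquareMajorant.norm_powI_sub_one_le (Skeleton.b1 c' D) hq.pos
  have hy := MeanSquareMajorant.norm_powI_sub_one_le (Skeleton.b2 c' D) hq.pos
  have hlog : 0 ≤ Real.log q := Real.log_natCast_nonneg q
  calc _ ≤ 4 * ‖(q : ℂ)⁻¹‖ * (‖MeanSquareMajorant.powI (Skeleton.b1 c' D) q - 1‖ +
        ‖MeanSquareMajorant.powI (Skeleton.b2 c' D) q - 1‖) := h
    _ ≤ 4 * ‖(q : ℂ)⁻¹‖ * (|Skeleton.b1 c' D| * Real.log q + |Skeleton.b2 c' D| * Real.log q) := by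
        gcongr
    _ = 4 * ((|Skeleton.b1 c' D| + |Skeleton.b2 c' D|) * Real.log q) * (q : ℝ)⁻¹ := by
        rw [AppendixALocal.norm_inv_natCast]; ring

/-! ## §5. `S₁₁ = Σ_{r≥1} ξ₁(qʳ;1,1)q^{−rs₀}` against `A0u/(1−u)` (App. A u025/u027) -/

/-- `χ(q)·q/(q−1) = χ(q)/(1 − q⁻¹)`. [cite: Zhang2022LandauSiegel, App. A (A.5) p. 103] -/
theorem chi_mul_div_sub_one_eq {q : ℕ} (hq : q.Prime) :
    χ (q : ZMod D) * (q : ℂ) / ((q : ℂ) - 1) = χ (q : ZMod D) / (1 - (q : ℂ)⁻¹) := by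
  have hqC : (q : ℂ) ≠ 0 := by exact_mod_cast hq.ne_zero
  have hq1 : (q : ℂ) - 1 ≠ 0 := by
    have : (1 : ℝ) < q := by exact_mod_cast hq.one_lt
    intro h
    have h' : (q : ℂ) = 1 := sub_eq_zero.mp h
    have : (q : ℝ) = 1 := by exact_mod_cast (by exact_mod_cast h' : (q : ℂ) = 1)
    linarith
  have hq1' : (1 : ℂ) - (q : ℂ)⁻¹ ≠ 0 := by
    intro h
    apply hq1
    have : (q : ℂ)⁻¹ = 1 := by linear_combination -h
    have := inv_eq_one.mp this
    rw [this]; ring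
  field_simp

/-- **`‖S₁₁ − A0u/(1−u)‖ ≤ 58Eu`** with `S₁₁ = Σ_{r≥1}ξ₁(qʳ;1,1)q^{−r(1−βⱼ)}`,
`A0 = 1/(1−vu) − v/(1−u)`, `E = (|b₁|+|b₂|+|bⱼ|)log q`: the tree's
`AppendixALocal.norm_rSumLocal_sub_le` at `w = x₀ = q⁻¹q^{βⱼ}` (error `38(|b₁|+|b₂|)log q·u`) plus
`‖x₀/(1−x₀) − u/(1−u)‖ ≤ 5‖x₀ − u‖ ≤ 5|bⱼ|log q·u` times `‖A0‖ ≤ 4`.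
[cite: Zhang2022LandauSiegel, App. A p. 104] -/
theorem norm_S11_sub_model_le [NeZero D] {q : ℕ} (hq : q.Prime) (j : ℕ) {b : ℝ}
    (hb : Skeleton.betaJ c' D j = (b : ℂ) * I) :
    ‖xi1LocalSeries c' χ q 1 1 (1 - Skeleton.betaJ c' D j) -
        (1 / (1 - χ (q : ZMod D) * (q : ℂ)⁻¹) - χ (q : ZMod D) / (1 - (q : ℂ)⁻¹)) *
          ((q : ℂ)⁻¹ / (1 - (q : ℂ)⁻¹))‖ ≤
      58 * ((|Skeleton.b1 c' D| + |Skeleton.b2 c' D| + |b|) * Real.log q) * (q : ℝ)⁻¹ := by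
  set v : ℂ := χ (q : ZMod D) with hv
  set u : ℂ := (q : ℂ)⁻¹ with hu
  set t : ℂ := (q : ℂ) ^ Skeleton.betaJ c' D j with ht
  set x₀ : ℂ := u * t with hx₀
  set A0 : ℂ := 1 / (1 - v * u) - v / (1 - u) with hA0
  set bb : ℝ := |Skeleton.b1 c' D| + |Skeleton.b2 c' D| with hbb
  set L : ℝ := Real.log q with hL
  have hL0 : 0 ≤ L := Real.log_natCast_nonneg q
  have hbb0 : 0 ≤ bb := by positivity
  have hq0 : (0 : ℝ) < q := by exact_mod_cast hq.pos
  have hq2 : (2 : ℝ) ≤ q := by exact_mod_cast hq.two_le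
  have hvn : ‖v‖ ≤ 1 := χ.norm_le_one _
  have hun : ‖u‖ = (q : ℝ)⁻¹ := by rw [hu, norm_inv, Complex.norm_natCast]
  have hu12 : ‖u‖ ≤ 1 / 2 := by rw [hun, one_div]; exact inv_anti₀ (by norm_num) hq2
  have htn : ‖t‖ = 1 := norm_cpow_betaJ c' hq j
  have hx₀n : ‖x₀‖ = (q : ℝ)⁻¹ := by rw [hx₀, norm_mul, hun, htn, mul_one]
  have hx₀35 : ‖x₀‖ ≤ 3 / 5 := by rw [hx₀n]; rw [hun] at hu12; linarith
  have hs₀ : 0 < (1 - Skeleton.betaJ c' D j).re := by rw [one_sub_betaJ_re]; norm_num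
  -- identify the series with the tree's `r`-sum
  set F : ℕ → ℂ := fun r => if r = 0 then (0 : ℂ) else
      xi1 c' χ (q ^ r) 1 1 / (q : ℂ) ^ ((r : ℂ) * (1 - Skeleton.betaJ c' D j)) with hF
  have hFsum : Summable F := summable_xi1LocalSeries_term c' χ hq 1 1 hs₀
  have hF0 : F 0 = 0 := by simp [hF]
  have hFm : ∀ m : ℕ, F (m + 1) = x₀ ^ (m + 1) *
      ((∑' k : ℕ, MeanSquareMajorant.kappa₁ (Skeleton.b1 c' D) (Skeleton.b2 c' D) (q ^ (m + 1 + k)) *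
          (v * (q : ℂ)⁻¹) ^ k) -
        v / (1 - (q : ℂ)⁻¹) * MeanSquareMajorant.kappa₁ (Skeleton.b1 c' D) (Skeleton.b2 c' D) (q ^ m)) := by
    intro m
    have hm : m + 1 ≠ 0 := by omega
    simp only [hF, if_neg hm]
    rw [div_eq_mul_inv, show (((m + 1 : ℕ) : ℂ)) = ((m + 1 : ℕ) : ℂ) from rfl,
      inv_cpow_nat_mul_eq c' hq j (m + 1), ← hu, ← ht, ← hx₀,
      xi1_prime_pow_of_coprime c' χ hq le_rfl le_rfl (by omega) (Nat.coprime_one_right q),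
      AppendixALocal.kappaTilde1_prime_pow_eq c' χ hq (by omega), Nat.add_sub_cancel,
      chi_mul_div_sub_one_eq χ hq]
    unfold kappa1
    rw [hv, mul_comm]
  have hS : xi1LocalSeries c' χ q 1 1 (1 - Skeleton.betaJ c' D j) = ∑' m, F (m + 1) := by
    unfold xi1LocalSeries
    change ∑' r, F r = _
    rw [hFsum.tsum_eq_zero_add, hF0, zero_add]
  have hmain := AppendixALocal.norm_rSumLocal_sub_le (Skeleton.b1 c' D) (Skeleton.b2 c' D) hvn hq hx₀35
  rw [hS, tsum_congr hFm]
  -- the passage `x₀ ↦ u` in the main term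
  have hA0n : ‖A0‖ ≤ 4 := by
    have h1 : ‖1 / (1 - v * u)‖ ≤ 2 := by
      rw [one_div, norm_inv]
      have := AppendixALocal.half_le_norm_one_sub hu12 hvn
      calc ‖1 - v * u‖⁻¹ ≤ (1 / 2)⁻¹ := inv_anti₀ (by norm_num) this
        _ = 2 := by norm_num
    have h2 : ‖v / (1 - u)‖ ≤ 2 := AppendixALocal.norm_div_one_sub_le_two hu12 hvn
    calc ‖A0‖ ≤ ‖1 / (1 - v * u)‖ + ‖v / (1 - u)‖ := norm_sub_le _ _
      _ ≤ 2 + 2 := add_le_add h1 h2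
      _ = 4 := by norm_num
  have hpass : ‖A0 * (x₀ / (1 - x₀)) - A0 * (u / (1 - u))‖ ≤ 20 * (|b| * L) * (q : ℝ)⁻¹ := by
    rw [← mul_sub, norm_mul]
    have h5 := AppendixALocal.norm_div_one_sub_sub_le hx₀35 hu12
    have hxu : ‖x₀ - u‖ ≤ |b| * L * (q : ℝ)⁻¹ := by
      rw [hx₀, show u * t - u = u * (t - 1) by ring, norm_mul, hun]
      have := norm_cpow_betaJ_sub_one_le c' hq j hb
      rw [← ht] at this
      calc (q : ℝ)⁻¹ * ‖t - 1‖ ≤ (q : ℝ)⁻¹ * (|b| * Real.log q) := by gcongr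
        _ = |b| * L * (q : ℝ)⁻¹ := by rw [hL]; ring
    calc ‖A0‖ * ‖x₀ / (1 - x₀) - u / (1 - u)‖ ≤ 4 * (5 * (|b| * L * (q : ℝ)⁻¹)) :=
          mul_le_mul hA0n (h5.trans (by linarith)) (norm_nonneg _) (by norm_num)
      _ = 20 * (|b| * L) * (q : ℝ)⁻¹ := by ring
  have e : (∑' m : ℕ, x₀ ^ (m + 1) *
      ((∑' k : ℕ, MeanSquareMajorant.kappa₁ (Skeleton.b1 c' D) (Skeleton.b2 c' D) (q ^ (m + 1 + k)) *
          (v * (q : ℂ)⁻¹) ^ k) -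
        v / (1 - (q : ℂ)⁻¹) * MeanSquareMajorant.kappa₁ (Skeleton.b1 c' D) (Skeleton.b2 c' D) (q ^ m))) -
      A0 * (u / (1 - u)) =
      ((∑' m : ℕ, x₀ ^ (m + 1) *
        ((∑' k : ℕ, MeanSquareMajorant.kappa₁ (Skeleton.b1 c' D) (Skeleton.b2 c' D) (q ^ (m + 1 + k)) *
            (v * (q : ℂ)⁻¹) ^ k) -
          v / (1 - (q : ℂ)⁻¹) * MeanSquareMajorant.kappa₁ (Skeleton.b1 c' D) (Skeleton.b2 c' D) (q ^ m))) -
        A0 * (x₀ / (1 - x₀))) + (A0 * (x₀ / (1 - x₀)) - A0 * (u / (1 - u))) := by ring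
  rw [e]
  calc _ ≤ 38 * (bb * L) * ‖x₀‖ + 20 * (|b| * L) * (q : ℝ)⁻¹ := by
        refine (norm_add_le _ _).trans (add_le_add ?_ hpass)
        simpa [hA0, hv, hu] using hmain
    _ = (38 * bb + 20 * |b|) * L * (q : ℝ)⁻¹ := by rw [hx₀n]; ring
    _ ≤ 58 * ((bb + |b|) * L) * (q : ℝ)⁻¹ := by
        have hqi : 0 ≤ (q : ℝ)⁻¹ := by positivity
        nlinarith [mul_nonneg (mul_nonneg hbb0 hL0) hqi, mul_nonneg (mul_nonneg (abs_nonneg b) hL0) hqi]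

end Literature.NumberTheory.LFunctions.Zhang2022.Lemma153Rp

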